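import Literature.AlgebraicGeometry.Resolution.HenselizationHenselian
import Literature.AlgebraicGeometry.Resolution.ValuationConjugation
import Literature.AlgebraicGeometry.Resolution.SmoothUniformization
import Mathlib.FieldTheory.IsAlgClosed.AlgebraicClosure
import HarnessLib

/-!
# The universal property of the henselization (Kuhlmann 2010, Lemma 2.2) — proofs

Topic: `Literature/AlgebraicGeometry/Resolution` (valued function fields). PROVED companion of
`Henselization.lean`: its named fact `Kuhlmann2010HenselizationUniversal` (F.-V. Kuhlmann,
*Elimination of ramification I*, Trans. AMS 362 (2010) = arXiv:1003.5678, Lemma 2.2: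

> The henselization `K^h` of a valued field `(K,v)` … has the following universal property:
> if `(L,v')` is an arbitrary henselian extension field of `(K,v)`, then there is a unique
> valuation preserving embedding of `(K^h,v)` in `(L,v')` over `K`.)

is DISCHARGED (`Kuhlmann2010HenselizationUniversal_holds`), in the ambient rendering of
`Henselization.lean` (an algebraically closed valued field `(Ω, V)`, a subfield `E ≤ Ω`,
`E^sep = separableClosure E Ω`, `E^h = henselization V E` the fixed field of the decomposition
group `D` of `V ∩ E^sep`). The source proves nothing here ("For the next results, and general
background in valuation theory, we refer the reader to [En], [R], [W], [Z–S]"); the proof below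
is the classical one (e.g. Engler–Prestel, *Valued Fields*, Thm. 5.2.2), resting on the
conjugation theorem `exists_smul_eq_of_isGalois` (`ValuationConjugation.lean`; Bourbaki, AC VI
§8 no. 6, Prop. 7, Cor. 1) and on `Gal(E^sep | E^h) = D` with its consequence
`mem_iff_mem_of_mem_separableClosure` (`HenselizationHenselian.lean`). The sibling named facts
`Kuhlmann2010ExtensionsConjugate` and `Kuhlmann2010HenselizationIsHenselian` are discharged in
`HenselizationProofs.lean` and `HenselizationHenselian.lean`.

## Content (everything PROVED)

* `eq_sepClosureValuationSubring_of_forall_mem_henselization` — **`V ∩ E^sep` is the only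
  valuation ring of `E^sep` inducing `V ∩ E^h` on `E^h`** (extend to `Ω` by Chevalley,
  `exists_valuationSubring_comap_eq` of `SmoothUniformization.lean`, and use
  `mem_iff_mem_of_mem_separableClosure`).
* `exists_algHom_henselization` — EXISTENCE in Lemma 2.2: for `(L, O_L)` henselian over
  `(E, V ∩ E)`, extend `O_L` to `O_M` on `M = L̄` (Chevalley), embed `E^sep → M` over `E`
  (`IsAlgClosed.lift`) and correct the embedding by the conjugation theorem over `E` so that
  `O_M` pulls back to `V ∩ E^sep`; every `L`-automorphism `τ` of `M` preserves `O_M`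
  (`L` henselian, `M | L` algebraic), so restricts (`AlgHom.restrictNormal'`) to an element of
  `D`, whence the image of `E^h` is fixed by `Aut(M | L)`; being separable over `L`, it lies in
  `L` (`InfiniteGalois.mem_bot_iff_fixed` in the separable closure of `L` in `M`).
* `algHom_henselization_ext` — UNIQUENESS in Lemma 2.2 (for any valued extension `(L, O_L)`,
  henselian or not): two valuation-compatible `E`-embeddings `ι₁, ι₂ : E^h → L` extend to
  `ρ₁, ρ₂ : E^sep → L̄` over `E^h`, pulling `O_{L̄}` back to valuation rings of `E^sep` over
  `V ∩ E^h`, hence both to `V ∩ E^sep` (first item); then `τ = ρ₂⁻¹ρ₁ ∈ Gal(E^sep | E)`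
  stabilises `V ∩ E^sep`, i.e. `τ ∈ D`, so `τ` fixes `E^h` and `ι₁ = ι₂`.
* `Kuhlmann2010HenselizationUniversal_holds` — Lemma 2.2, the universal property (`∃!`).

## Sources

* F.-V. Kuhlmann, Trans. Amer. Math. Soc. 362 (2010) 5697–5727 = arXiv:1003.5678, §1.1 and
  Lemma 2.2 (p. 5 of the arXiv version).
* N. Bourbaki, *Algèbre commutative* Ch. VI §8 no. 6, Prop. 7, Cor. 1 (conjugation theorem).
-/

noncomputable section

open scoped Pointwise

namespace Literature.AlgebraicGeometry.Resolution

universe u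

section Ambient

variable {Ω : Type u} [Field Ω] [IsAlgClosed Ω] (V : ValuationSubring Ω) (E : Subfield Ω)

/-! ### `V ∩ E^sep` is the unique extension of `V ∩ E^h` to `E^sep` -/

/-- **The valuation of the henselization extends uniquely to the separable closure**: a
valuation ring `W` of `E^sep` which agrees with `V` on `E^h` is `V ∩ E^sep` — the form, for
valuation rings of `E^sep` itself (as pulled back along embeddings `E^sep → L̄`), of
`mem_iff_mem_of_mem_separableClosure` (`HenselizationHenselian.lean`: the same for valuation
rings of `Ω`, by the conjugation theorem over `E^h` and `Gal(E^sep | E^h) = D`), to which it is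
reduced by extending `W` to `Ω` (Chevalley). (The henselian property of `(E^h, V ∩ E^h)` on
`E^sep`, Kuhlmann 2010, §1.1.) [cite: Kuhlmann2010, Section 1.1] -/
theorem eq_sepClosureValuationSubring_of_forall_mem_henselization
    (W : ValuationSubring (separableClosure E Ω))
    (hW : ∀ z : separableClosure E Ω, (z : Ω) ∈ henselization V E → (z ∈ W ↔ (z : Ω) ∈ V)) :
    W = sepClosureValuationSubring V E := by
  -- extend `W` to a valuation ring `P` of `Ω` (Chevalley) and compare `P` with `V` on `E^sep`
  obtain ⟨P, hP⟩ := exists_valuationSubring_comap_eq (Ω := Ω) W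
  have hPV : ∀ x ∈ henselization V E, x ∈ P ↔ x ∈ V := fun x hx => by
    have h := hW ⟨x, henselization_le_separableClosure V E hx⟩ hx
    rw [← hP, ValuationSubring.mem_comap] at h
    exact h
  ext z
  have h1 : (z : Ω) ∈ P ↔ (z : Ω) ∈ V := mem_iff_mem_of_mem_separableClosure V E P hPV z.2
  have h2 : z ∈ W ↔ (z : Ω) ∈ P := (SetLike.ext_iff.mp hP z).symm
  rw [mem_sepClosureValuationSubring_iff]
  exact h2.trans h1

/-! ### Lemma 2.2: existence of the embedding -/

/-- **Kuhlmann 2010, Lemma 2.2, existence**: for a henselian valued field `(L, O_L)` extending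
`(E, V ∩ E)` there is an `E`-embedding `ι : E^h → L` with `ι⁻¹(O_L) = V ∩ E^h`. PROVED (see the
module docstring for the argument). [cite: Kuhlmann2010, Lemma 2.2] -/
theorem exists_algHom_henselization (L : Type u) [Field L] [Algebra E L] (OL : ValuationSubring L)
    (hL : IsHenselianField L OL) (hOL : OL.comap (algebraMap E L) = V.comap (algebraMap E Ω)) :
    ∃ ι : henselization V E →ₐ[E] L,
      OL.comap ι.toRingHom = V.comap (algebraMap (henselization V E) Ω) := by
  classical
  -- the (unique) extension `O_M` of `O_L` to `M = L̄`; it is preserved by `Aut(M | L)`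
  obtain ⟨OM, hOM⟩ := exists_valuationSubring_comap_eq (Ω := AlgebraicClosure L) OL
  have hτ : ∀ (τ : AlgebraicClosure L ≃ₐ[L] AlgebraicClosure L) (z : AlgebraicClosure L),
      z ∈ OM ↔ τ z ∈ OM := by
    intro τ z
    have hcomp : τ.toAlgHom.toRingHom.comp (algebraMap L (AlgebraicClosure L)) =
        algebraMap L (AlgebraicClosure L) := RingHom.ext fun c => τ.commutes c
    have hA : OM = OM.comap τ.toAlgHom.toRingHom :=
      hL (AlgebraicClosure L) inferInstance OM _ hOM
        (by rw [ValuationSubring.comap_comap, hcomp, hOM])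
    exact SetLike.ext_iff.mp hA z
  -- an `E`-embedding `φ : E^sep → M` along which `O_M` pulls back to `V ∩ E^sep`
  obtain ⟨φ, hφ⟩ : ∃ φ : separableClosure E Ω →ₐ[E] AlgebraicClosure L,
      OM.comap φ.toRingHom = sepClosureValuationSubring V E := by
    let φ₀ : separableClosure E Ω →ₐ[E] AlgebraicClosure L := IsAlgClosed.lift
    have h0 : (OM.comap φ₀.toRingHom).comap (algebraMap E (separableClosure E Ω)) =
        (sepClosureValuationSubring V E).comap (algebraMap E (separableClosure E Ω)) := by
      ext c
      rw [ValuationSubring.mem_comap, ValuationSubring.mem_comap, ValuationSubring.mem_comap,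
        mem_sepClosureValuationSubring_iff]
      change φ₀ (algebraMap E (separableClosure E Ω) c) ∈ OM ↔ ((c : E) : Ω) ∈ V
      rw [φ₀.commutes, IsScalarTower.algebraMap_apply E L (AlgebraicClosure L),
        ← ValuationSubring.mem_comap, hOM, ← ValuationSubring.mem_comap, hOL]
      rfl
    obtain ⟨σ, hσ⟩ := exists_smul_eq_of_isGalois E (OM.comap φ₀.toRingHom)
      (sepClosureValuationSubring V E) h0
    refine ⟨φ₀.comp σ.symm.toAlgHom, ?_⟩
    rw [← hσ]
    ext z
    rw [ValuationSubring.mem_comap, ValuationSubring.mem_pointwise_smul_iff_inv_smul_mem,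
      AlgEquiv.smul_def, AlgEquiv.aut_inv, ValuationSubring.mem_comap]
    rfl
  have hφV : ∀ z : separableClosure E Ω, φ z ∈ OM ↔ (z : Ω) ∈ V := fun z =>
    SetLike.ext_iff.mp hφ z
  -- every `L`-automorphism of `M` fixes `φ(E^h)` pointwise
  have hfix : ∀ (τ : AlgebraicClosure L ≃ₐ[L] AlgebraicClosure L) (z : separableClosure E Ω),
      (z : Ω) ∈ henselization V E → τ (φ z) = φ z := by
    intro τ z hz
    obtain ⟨hzs, hDz⟩ := (mem_henselization_iff V E).mp hz
    letI : Algebra (separableClosure E Ω) (AlgebraicClosure L) := φ.toRingHom.toAlgebra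
    haveI : IsScalarTower E (separableClosure E Ω) (AlgebraicClosure L) :=
      IsScalarTower.of_algebraMap_eq fun c => (φ.commutes c).symm
    obtain ⟨σ, hσ⟩ : ∃ σ : (separableClosure E Ω) ≃ₐ[E] (separableClosure E Ω),
        ∀ w : separableClosure E Ω, φ (σ w) = τ (φ w) := by
      refine ⟨((τ.restrictScalars E).toAlgHom.comp φ).restrictNormal' (separableClosure E Ω),
        fun w => ?_⟩
      rw [AlgHom.restrictNormal', AlgEquiv.coe_ofBijective]
      exact AlgHom.restrictNormal_commutes _ (separableClosure E Ω) w
    have hσD : σ ∈ decompositionGroup V E := by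
      have key : ∀ w : separableClosure E Ω, ((σ⁻¹ w : separableClosure E Ω) : Ω) ∈ V ↔
          (w : Ω) ∈ V := fun w => by
        rw [← hφV, ← hφV, hτ τ (φ (σ⁻¹ w)), ← hσ, AlgEquiv.aut_inv, AlgEquiv.apply_symm_apply]
      rw [mem_decompositionGroup_iff]
      ext w
      rw [ValuationSubring.mem_pointwise_smul_iff_inv_smul_mem, mem_sepClosureValuationSubring_iff,
        mem_sepClosureValuationSubring_iff, AlgEquiv.smul_def]
      exact key w
    have hfixz : σ z = z := hDz σ hσD
    rw [← hσ, hfixz]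
  -- hence `φ(E^h) ⊆ L`: a fixed element separable over `L` lies in `L`
  have hrange : ∀ z : separableClosure E Ω, (z : Ω) ∈ henselization V E →
      ∃ y : L, algebraMap L (AlgebraicClosure L) y = φ z := by
    intro z hz
    have hsepE : IsSeparable E (φ z) := by
      have h1 : IsSeparable E z := Algebra.IsSeparable.isSeparable E z
      unfold IsSeparable at h1 ⊢
      rwa [minpoly.algHom_eq φ φ.toRingHom.injective]
    have hsep : IsSeparable L (φ z) := IsSeparable.tower_top L hsepE
    have hmem : φ z ∈ separableClosure L (AlgebraicClosure L) := mem_separableClosure_iff.mpr hsep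
    have hall : ∀ ρ : (separableClosure L (AlgebraicClosure L)) ≃ₐ[L]
        (separableClosure L (AlgebraicClosure L)), ρ ⟨φ z, hmem⟩ = ⟨φ z, hmem⟩ := by
      intro ρ
      apply Subtype.ext
      have hc := AlgEquiv.liftNormal_commutes ρ (AlgebraicClosure L) ⟨φ z, hmem⟩
      change (ρ.liftNormal (AlgebraicClosure L)) (φ z) = ((ρ ⟨φ z, hmem⟩ : _) : AlgebraicClosure L)
        at hc
      rw [← hc]
      exact hfix _ z hz
    obtain ⟨y, hy⟩ := IntermediateField.mem_bot.mp
      ((InfiniteGalois.mem_bot_iff_fixed (k := L) (⟨φ z, hmem⟩ :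
        separableClosure L (AlgebraicClosure L))).mpr hall)
    exact ⟨y, congrArg (fun w : separableClosure L (AlgebraicClosure L) => (w : AlgebraicClosure L)) hy⟩
  -- the embedding `ι : E^h → L`, `ι(x) = φ(x)` read in `L`
  have hle : henselization V E ≤ (separableClosure E Ω).toSubfield :=
    henselization_le_separableClosure V E
  let incl : henselization V E →+* separableClosure E Ω :=
    (algebraMap (henselization V E) Ω).codRestrict (separableClosure E Ω) fun x => hle x.2
  choose f hf using hrange
  have hinj : Function.Injective (algebraMap L (AlgebraicClosure L)) :=
    (algebraMap L (AlgebraicClosure L)).injective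
  let g : henselization V E → L := fun x => f (incl x) x.2
  have hg : ∀ x, algebraMap L (AlgebraicClosure L) (g x) = φ (incl x) := fun x => hf (incl x) x.2
  let ι₀ : henselization V E →+* L :=
    { toFun := g
      map_one' := hinj (by rw [hg, map_one, map_one, map_one])
      map_mul' := fun x y => hinj (by rw [hg, map_mul, map_mul, map_mul, hg, hg])
      map_zero' := hinj (by rw [hg, map_zero, map_zero, map_zero])
      map_add' := fun x y => hinj (by rw [hg, map_add, map_add, map_add, hg, hg]) }
  have hι₀ : ∀ x, algebraMap L (AlgebraicClosure L) (ι₀ x) = φ (incl x) := hg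
  let ι : henselization V E →ₐ[E] L :=
    { ι₀ with
      commutes' := fun c => hinj (by
        change algebraMap L (AlgebraicClosure L) (ι₀ (algebraMap E (henselization V E) c)) = _
        rw [hι₀]
        change φ (algebraMap E (separableClosure E Ω) c) = _
        rw [φ.commutes, IsScalarTower.algebraMap_apply E L (AlgebraicClosure L)]) }
  have hι : ∀ x, algebraMap L (AlgebraicClosure L) (ι x) = φ (incl x) := hg
  refine ⟨ι, ?_⟩
  ext x
  rw [ValuationSubring.mem_comap, ValuationSubring.mem_comap]
  change ι x ∈ OL ↔ (x : Ω) ∈ V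
  rw [← hOM, ValuationSubring.mem_comap, hι, hφV]
  rfl

/-! ### Lemma 2.2: uniqueness of the embedding -/

/-- **Kuhlmann 2010, Lemma 2.2, uniqueness**: two `E`-embeddings `ι₁, ι₂ : E^h → L` into a
valued field `(L, O_L)` with `ιₖ⁻¹(O_L) = V ∩ E^h` coincide (no henselian hypothesis on `L` is
needed for this half). PROVED (see the module docstring). [cite: Kuhlmann2010, Lemma 2.2] -/
theorem algHom_henselization_ext (L : Type u) [Field L] [Algebra E L] (OL : ValuationSubring L)
    (ι₁ ι₂ : henselization V E →ₐ[E] L)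
    (h₁ : OL.comap ι₁.toRingHom = V.comap (algebraMap (henselization V E) Ω))
    (h₂ : OL.comap ι₂.toRingHom = V.comap (algebraMap (henselization V E) Ω)) : ι₁ = ι₂ := by
  classical
  obtain ⟨OM, hOM⟩ := exists_valuationSubring_comap_eq (Ω := AlgebraicClosure L) OL
  -- `E ≤ E^h ≤ E^sep`
  have hle : henselization V E ≤ (separableClosure E Ω).toSubfield :=
    henselization_le_separableClosure V E
  let incl : henselization V E →+* separableClosure E Ω :=
    (algebraMap (henselization V E) Ω).codRestrict (separableClosure E Ω) fun x => hle x.2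
  letI : Algebra (henselization V E) (separableClosure E Ω) := incl.toAlgebra
  haveI : IsScalarTower E (henselization V E) (separableClosure E Ω) :=
    IsScalarTower.of_algebraMap_eq fun _ => rfl
  haveI : Algebra.IsAlgebraic (henselization V E) (separableClosure E Ω) :=
    Algebra.IsAlgebraic.tower_top (K := E) (henselization V E)
  -- extend `ιₖ` to `ρₖ : E^sep → M`; its valuation ring pulls back to `V ∩ E^sep`
  have hext : ∀ ι : henselization V E →ₐ[E] L,
      OL.comap ι.toRingHom = V.comap (algebraMap (henselization V E) Ω) →
      ∃ ρ : separableClosure E Ω →ₐ[E] AlgebraicClosure L,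
        (∀ x : henselization V E, ρ (incl x) = algebraMap L (AlgebraicClosure L) (ι x)) ∧
        ∀ w : separableClosure E Ω, ρ w ∈ OM ↔ (w : Ω) ∈ V := by
    intro ι hι
    letI : Algebra (henselization V E) (AlgebraicClosure L) :=
      ((algebraMap L (AlgebraicClosure L)).comp ι.toRingHom).toAlgebra
    haveI : IsScalarTower E (henselization V E) (AlgebraicClosure L) :=
      IsScalarTower.of_algebraMap_eq fun c => by
        change algebraMap E (AlgebraicClosure L) c =
          algebraMap L (AlgebraicClosure L) (ι (algebraMap E (henselization V E) c))
        rw [ι.commutes, ← IsScalarTower.algebraMap_apply]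
    let ρ' : separableClosure E Ω →ₐ[henselization V E] AlgebraicClosure L := IsAlgClosed.lift
    have hρ' : ∀ x : henselization V E, ρ' (incl x) = algebraMap L (AlgebraicClosure L) (ι x) :=
      fun x => ρ'.commutes x
    refine ⟨ρ'.restrictScalars E, hρ', fun w => ?_⟩
    have hW : OM.comap ρ'.toRingHom = sepClosureValuationSubring V E := by
      refine eq_sepClosureValuationSubring_of_forall_mem_henselization V E _ fun z hz => ?_
      have hz' : z = incl ⟨z, hz⟩ := Subtype.ext rfl
      rw [ValuationSubring.mem_comap]
      change ρ' z ∈ OM ↔ _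
      rw [hz', hρ', ← ValuationSubring.mem_comap, hOM]
      exact SetLike.ext_iff.mp hι ⟨z, hz⟩
    exact SetLike.ext_iff.mp hW w
  obtain ⟨ρ₁, hρ₁, hW₁⟩ := hext ι₁ h₁
  obtain ⟨ρ₂, hρ₂, hW₂⟩ := hext ι₂ h₂
  -- `τ = ρ₂⁻¹ ρ₁ ∈ Gal(E^sep | E)` lies in `D`
  letI : Algebra (separableClosure E Ω) (AlgebraicClosure L) := ρ₂.toRingHom.toAlgebra
  haveI : IsScalarTower E (separableClosure E Ω) (AlgebraicClosure L) :=
    IsScalarTower.of_algebraMap_eq fun c => (ρ₂.commutes c).symm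
  obtain ⟨τ, hτ⟩ : ∃ τ : (separableClosure E Ω) ≃ₐ[E] (separableClosure E Ω),
      ∀ w : separableClosure E Ω, ρ₂ (τ w) = ρ₁ w := by
    refine ⟨ρ₁.restrictNormal' (separableClosure E Ω), fun w => ?_⟩
    rw [AlgHom.restrictNormal', AlgEquiv.coe_ofBijective]
    exact AlgHom.restrictNormal_commutes ρ₁ (separableClosure E Ω) w
  have hτD : τ ∈ decompositionGroup V E := by
    rw [mem_decompositionGroup_iff]
    ext w
    rw [ValuationSubring.mem_pointwise_smul_iff_inv_smul_mem, AlgEquiv.smul_def,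
      mem_sepClosureValuationSubring_iff, mem_sepClosureValuationSubring_iff, ← hW₁, ← hτ,
      AlgEquiv.aut_inv, AlgEquiv.apply_symm_apply]
    exact hW₂ w
  -- `τ` fixes `E^h`, so `ι₁ = ι₂`
  apply AlgHom.ext
  intro x
  have hx : τ (incl x) = incl x := ((mem_henselization_iff V E).mp x.2).2 τ hτD
  apply (algebraMap L (AlgebraicClosure L)).injective
  rw [← hρ₁, ← hρ₂, ← hτ, hx]

/-- **Kuhlmann 2010, Lemma 2.2 — the universal property of the henselization**, DISCHARGED:
the named fact `Kuhlmann2010HenselizationUniversal` of `Henselization.lean` holds ("if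
`(L,v')` is an arbitrary henselian extension field of `(K,v)`, then there is a unique
valuation preserving embedding of `(K^h,v)` in `(L,v')` over `K`"), from
`exists_algHom_henselization` and `algHom_henselization_ext`. [cite: Kuhlmann2010, Lemma 2.2] -/
theorem Kuhlmann2010HenselizationUniversal_holds : Kuhlmann2010HenselizationUniversal.{u} := by
  intro Ω _ _ V E L _ _ OL hL hOL
  obtain ⟨ι, hι⟩ := exists_algHom_henselization V E L OL hL hOL
  exact ⟨ι, hι, fun ι' hι' => algHom_henselization_ext V E L OL ι' ι hι' hι⟩

end Ambient

end Literature.AlgebraicGeometry.Resolution
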